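import Mathlib

/-!
# The matching arithmetic of PERIOD.md §4.7 — (E5-b) by construction (T3.1, seat t3-p1)

PERIOD.md §4.7 (TIER3.md §3 R-D′ / R-G, §5) matches, place by place, the archimedean type of the
period closer's fixed datum with the lowest `K`-type of the endoscopic lift `Θ(β_v)`, in the
GENUINE (Fock-vacuum) normalisation, where every type is a pair of half-integers: the datum's
`U(W_v)`-type is `(3/2, 3/2)` on a definite `W_v` (the Gaussian, and the Kudla–Millson
`(2,0)`-form at `w₀`) and `(3/2; -3/2)` on a mixed `W_v`; the lift of a `U(1)`-character from a
line `L` of sign `s = ±1` at `v` has lowest `K`-type `(s/2 + a, s/2)` on a definite `W_v` and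
`(s/2 + a; -s/2)` or `(s/2; -s/2 - b)` on a mixed `W_v` (`a, b ≥ 0` the degree) — Konno–Konno
2007 Lemma 5.3 as read there, with BMM Acta 216 (2016) Prop 52(6)–(8) / Lemma 53 as the legible
published page (PERIOD-ADDENDUM-4).  HONEST (splitting-normalised) types are the genuine ones
shifted by `w/2` on every entry, `w` the ODD archimedean weight of the pair's splitting character,
so two honest types agree iff the genuine ones differ by `((w₂ - w₁)/2)·(1, 1)`, and a change of a
splitting character by an even weight shifts the honest type by ANY prescribed integer.

This file records that arithmetic on the kernel: `honest_eq_iff` (the matching condition),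
`even_sub_of_odd` / `exists_odd_weight_of_shift` (the twist is an integer, and every integer twist
is available), the three matching equations with their UNIQUE solutions `(a, e)` in terms of the
sign `s` (`definite_match`, `mixed_match`, `mixed_match'`), the evenness of the required twist for
every odd sign (`even_twist_of_odd`), the existence statement for `s = ±1`
(`exists_match_definite`, `exists_match_mixed` — NO sign pattern of `L` is obstructed) and the four
rows of §4.7's table (`table_rows`).  Integer / rational identities only; the file declares no
definition and no notation, and nothing here asserts anything about the Hodge conjecture, which is
NOT proved by anyone in this repository.
-/

namespace HodgeRepro.T3P1.GenuineMatching

/-- THE MATCHING CONDITION. Honest types `g + (w/2)·(1,1)` built from genuine types `g₁, g₂` with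
splitting weights `w₁, w₂` agree iff the genuine types differ by `((w₂ - w₁)/2)·(1, 1)`. -/
theorem honest_eq_iff (g₁ g₂ : ℚ × ℚ) (w₁ w₂ : ℤ) :
    g₁ + ((w₁ : ℚ) / 2) • ((1 : ℚ), (1 : ℚ)) = g₂ + ((w₂ : ℚ) / 2) • ((1 : ℚ), (1 : ℚ)) ↔
      g₁ - g₂ = (((w₂ - w₁ : ℤ) : ℚ) / 2) • ((1 : ℚ), (1 : ℚ)) := by
  simp only [Prod.ext_iff, Prod.fst_add, Prod.snd_add, Prod.fst_sub, Prod.snd_sub, Prod.smul_fst,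
    Prod.smul_snd, smul_eq_mul, mul_one, Int.cast_sub]
  constructor
  · rintro ⟨h1, h2⟩
    exact ⟨by linarith, by linarith⟩
  · rintro ⟨h1, h2⟩
    exact ⟨by linarith, by linarith⟩

/-- Both splitting characters have ODD archimedean weight, so the required twist `(w₂ - w₁)/2`
is an integer: the difference of two odd integers is even. -/
theorem even_sub_of_odd {w₁ w₂ : ℤ} (h₁ : Odd w₁) (h₂ : Odd w₂) : Even (w₂ - w₁) :=
  h₂.sub_odd h₁

/-- EVERY INTEGER TWIST IS AVAILABLE: changing the splitting character by the even weight `2k`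
keeps it odd and shifts the honest type by exactly `k` on both entries. -/
theorem exists_odd_weight_of_shift (w₁ : ℤ) (hw₁ : Odd w₁) (k : ℤ) :
    ∃ w₂ : ℤ, Odd w₂ ∧ ((w₂ - w₁ : ℤ) : ℚ) / 2 = k := by
  refine ⟨w₁ + 2 * k, hw₁.add_even (even_two_mul k), ?_⟩
  push_cast
  ring

/-- DEFINITE `W_v` (and `w₀`): `(3/2, 3/2) - (s/2 + a, s/2) = (e/2)·(1,1)` iff `a = 0` and
`e = 3 - s` — the matching member is the vacuum `a = 0` and the twist is forced. -/
theorem definite_match (s : ℤ) (a : ℕ) (e : ℤ) :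
    ((3 : ℚ) / 2, (3 : ℚ) / 2) - ((s : ℚ) / 2 + a, (s : ℚ) / 2) =
        ((e : ℚ) / 2) • ((1 : ℚ), (1 : ℚ)) ↔
      a = 0 ∧ e = 3 - s := by
  simp only [Prod.ext_iff, Prod.fst_sub, Prod.snd_sub, Prod.smul_fst, Prod.smul_snd, smul_eq_mul,
    mul_one]
  constructor
  · rintro ⟨h1, h2⟩
    have he : (e : ℚ) = 3 - s := by linarith
    have ha : (a : ℚ) = 0 := by linarith
    exact ⟨by exact_mod_cast ha, by exact_mod_cast he⟩
  · rintro ⟨rfl, rfl⟩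
    push_cast
    constructor <;> ring

/-- MIXED `W_v`, first shape: `(3/2; -3/2) - (s/2 + a; -s/2) = (e/2)·(1,1)` iff `a = 3 - s` and
`e = s - 3` (for `s = 1`: `a = 2`, `e = -2`; for `s = -1`: `a = 4`, `e = -4`). -/
theorem mixed_match (s : ℤ) (a : ℕ) (e : ℤ) :
    ((3 : ℚ) / 2, -((3 : ℚ) / 2)) - ((s : ℚ) / 2 + a, -((s : ℚ) / 2)) =
        ((e : ℚ) / 2) • ((1 : ℚ), (1 : ℚ)) ↔
      (a : ℤ) = 3 - s ∧ e = s - 3 := by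
  simp only [Prod.ext_iff, Prod.fst_sub, Prod.snd_sub, Prod.smul_fst, Prod.smul_snd, smul_eq_mul,
    mul_one]
  constructor
  · rintro ⟨h1, h2⟩
    have he : (e : ℚ) = s - 3 := by linarith
    have ha : (a : ℚ) = 3 - s := by linarith
    exact ⟨by exact_mod_cast ha, by exact_mod_cast he⟩
  · rintro ⟨ha, rfl⟩
    have ha' : (a : ℚ) = 3 - s := by exact_mod_cast ha
    push_cast
    rw [ha']
    constructor <;> ring

/-- MIXED `W_v`, second shape: `(3/2; -3/2) - (s/2; -s/2 - b) = (e/2)·(1,1)` iff `b = 3 - s` and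
`e = 3 - s` — a second admissible member, with the opposite twist. -/
theorem mixed_match' (s : ℤ) (b : ℕ) (e : ℤ) :
    ((3 : ℚ) / 2, -((3 : ℚ) / 2)) - ((s : ℚ) / 2, -((s : ℚ) / 2) - b) =
        ((e : ℚ) / 2) • ((1 : ℚ), (1 : ℚ)) ↔
      (b : ℤ) = 3 - s ∧ e = 3 - s := by
  simp only [Prod.ext_iff, Prod.fst_sub, Prod.snd_sub, Prod.smul_fst, Prod.smul_snd, smul_eq_mul,
    mul_one]
  constructor
  · rintro ⟨h1, h2⟩
    have he : (e : ℚ) = 3 - s := by linarith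
    have hb : (b : ℚ) = 3 - s := by linarith
    exact ⟨by exact_mod_cast hb, by exact_mod_cast he⟩
  · rintro ⟨hb, rfl⟩
    have hb' : (b : ℚ) = 3 - s := by exact_mod_cast hb
    push_cast
    rw [hb']
    constructor <;> ring

/-- For an ODD sign `s` (in particular `s = ±1`) the forced twists `3 - s` and `s - 3` are EVEN:
the required weight difference `w₂ - w₁` is always even, so no sign pattern of `L` is
obstructed. -/
theorem even_twist_of_odd {s : ℤ} (hs : Odd s) : Even (3 - s) ∧ Even (s - 3) := by
  have h3 : Odd (3 : ℤ) := ⟨1, by norm_num⟩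
  exact ⟨h3.sub_odd hs, hs.sub_odd h3⟩

/-- EXISTENCE at a definite place (and at `w₀`), for either sign of `L`: a degree `a` and an
EVEN twist `e` with `(3/2, 3/2) - (s/2 + a, s/2) = (e/2)·(1,1)`. -/
theorem exists_match_definite (s : ℤ) (hs : s = 1 ∨ s = -1) :
    ∃ a : ℕ, ∃ e : ℤ, Even e ∧
      ((3 : ℚ) / 2, (3 : ℚ) / 2) - ((s : ℚ) / 2 + a, (s : ℚ) / 2) =
        ((e : ℚ) / 2) • ((1 : ℚ), (1 : ℚ)) := by
  refine ⟨0, 3 - s, (even_twist_of_odd ?_).1, (definite_match s 0 (3 - s)).2 ⟨rfl, rfl⟩⟩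
  rcases hs with rfl | rfl
  · exact ⟨0, by norm_num⟩
  · exact ⟨-1, by norm_num⟩

/-- EXISTENCE at a mixed place, for either sign of `L`: a degree `a` and an EVEN twist `e` with
`(3/2; -3/2) - (s/2 + a; -s/2) = (e/2)·(1,1)`. -/
theorem exists_match_mixed (s : ℤ) (hs : s = 1 ∨ s = -1) :
    ∃ a : ℕ, ∃ e : ℤ, Even e ∧
      ((3 : ℚ) / 2, -((3 : ℚ) / 2)) - ((s : ℚ) / 2 + a, -((s : ℚ) / 2)) =
        ((e : ℚ) / 2) • ((1 : ℚ), (1 : ℚ)) := by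
  rcases hs with rfl | rfl
  · exact ⟨2, -2, ⟨-1, by norm_num⟩, (mixed_match 1 2 (-2)).2 ⟨by norm_num, by norm_num⟩⟩
  · exact ⟨4, -4, ⟨-2, by norm_num⟩, (mixed_match (-1) 4 (-4)).2 ⟨by norm_num, by norm_num⟩⟩

/-- THE FOUR ROWS OF §4.7's TABLE: definite `W_v` (or `w₀`), `L` positive — `a = 0`,
`w₂ - w₁ = 2`; `L` negative — `a = 0`, `w₂ - w₁ = 4`; mixed `W_v`, `L` positive — `a = 2`,
`w₂ - w₁ = -2`; `L` negative — `a = 4`, `w₂ - w₁ = -4`. -/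
theorem table_rows :
    (((3 : ℚ) / 2, (3 : ℚ) / 2) - (((1 : ℤ) : ℚ) / 2 + (0 : ℕ), ((1 : ℤ) : ℚ) / 2) =
        (((2 : ℤ) : ℚ) / 2) • ((1 : ℚ), (1 : ℚ))) ∧
    (((3 : ℚ) / 2, (3 : ℚ) / 2) - (((-1 : ℤ) : ℚ) / 2 + (0 : ℕ), ((-1 : ℤ) : ℚ) / 2) =
        (((4 : ℤ) : ℚ) / 2) • ((1 : ℚ), (1 : ℚ))) ∧
    (((3 : ℚ) / 2, -((3 : ℚ) / 2)) - (((1 : ℤ) : ℚ) / 2 + (2 : ℕ), -(((1 : ℤ) : ℚ) / 2)) =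
        (((-2 : ℤ) : ℚ) / 2) • ((1 : ℚ), (1 : ℚ))) ∧
    (((3 : ℚ) / 2, -((3 : ℚ) / 2)) - (((-1 : ℤ) : ℚ) / 2 + (4 : ℕ), -(((-1 : ℤ) : ℚ) / 2)) =
        (((-4 : ℤ) : ℚ) / 2) • ((1 : ℚ), (1 : ℚ))) :=
  ⟨(definite_match 1 0 2).2 ⟨rfl, by norm_num⟩, (definite_match (-1) 0 4).2 ⟨rfl, by norm_num⟩,
    (mixed_match 1 2 (-2)).2 ⟨by norm_num, by norm_num⟩,
    (mixed_match (-1) 4 (-4)).2 ⟨by norm_num, by norm_num⟩⟩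

end HodgeRepro.T3P1.GenuineMatching
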